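import Literature.Computability.Complexity.GateEliminationCase54Leaves
import Literature.Computability.Complexity.GateEliminationCase81Dispatch

/-!
# Gate elimination: Case 5.4 of Li–Yang's proof of Theorem 4.1 — the dispatcher

Case 5.4 of §4.1 (ECCC TR21-023, pp. 29–33): "`D` is disconnected (in both directions) with `B` …
We now substitute constant value to `x` to trivialize `G`. By normalization lemma, a newly
introduced troubled gate is either one of `I₁` and `I₂`, or fed by `I₁` or `I₂` after the
normalization." This file PROVES the reduction of Case 5.4 (`LiYang2022_case5_4_holds_aux`) to the four
printed leaves that need new substitution machinery, taken as explicit hypotheses stated over the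
local wiring (`hF3`: Case 5.4.1.1.3, affine substitution `x ← t ⊕ c` with `E` fed by `B` and
`D`; `hF7`: Case 5.4.2 with `B` a `2`-gate, affine substitution; `hF6`: Case 5.4.1.4, the
quadratic substitution; `hF5`: Case 5.4.1.3, a second substitution to a protected variable), by
a complete analysis of the chain `x := b`; `G`, `D`, `B` (`GateEliminationCase5Chain.lean`) under the
standing assumptions; the other leaves are the proved moves `stepGoal_two_consts` (5.4.2, `B` a
`1`-gate), `stepGoal_two_consts_readers` (5.4.1.1.2), `stepGoal_trivialize_mid` (5.4.1.2),
`stepGoal_trivialize_reader` (5.4.1.1.1). Once the four leaves are theorems,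
`LiYang2022_case5_4` follows by instantiating the hypotheses.

## References

* J. Li, T. Yang, *3.1n − o(n) circuit lower bounds for explicit functions*, STOC 2022;
  ECCC TR21-023, §4.1 (Case 5.4), Lemma 3.11.
-/

namespace Literature.Computability.Complexity

open Finset

namespace Semicircuit

variable {n : ℕ} {C : Semicircuit n} {f : (Fin n → ZMod 2) → Bool} {R : RdqSource n} {d : ℕ}
  {αφ αI αQ : ℝ} {G : Fin C.m} {x y : Fin n} {B C' D : Fin C.m} {aX aB aC aD : Fin 2}

/-- A ⊕-type gate stays ⊕-type after an elimination (its function changes by negations only). [folklore] -/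
theorem ElimDataW.isXorOp_of {k₀ : Fin C.m} {P : Finset (Fin C.m × Fin C.m)} {δ : ℝ}
    (E : ElimDataW C k₀ f R αφ αI αQ P δ) {k' : Fin E.C'.m} (h : IsXorOp (C.op (E.ι k'))) : IsXorOp (E.C'.op k') := by
  obtain ⟨σ, τ, -, hop⟩ := E.op_eq k'
  obtain ⟨c, hc⟩ := h
  refine ⟨((σ 0 ^^ σ 1) ^^ c) ^^ τ, fun p q => ?_⟩
  rw [hop, hc]
  cases p <;> cases q <;> cases σ 0 <;> cases σ 1 <;> cases c <;> cases τ <;> rfl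

section MainOf

variable (hf : IsAffineDisperser f d) (hd : 2 * d + 2 < R.dim) (hF : C.Fair) (hC : C.ComputesRestr f R)
  (hS : C.Standing R) (hcfg : C.Case5Config G x y B C' D aX aB aC aD) (hφ : 0 ≤ αφ) (hI : 0 ≤ αI) (αQ : ℝ)

include hf hd hF hC hS hcfg hφ hI in
/-- **The main strategy of Case 5** (global form) for any third elimination at `B` (used with a
bypass when `B` is ⊕-type, whose replacement node is then known). [cite: LiYang2022, §4.1 (Case 5)] -/
theorem case5_main'_of {δ₃ : ℝ}
    (E₃ : ElimDataW (case5E₂ hf hd hF hC hS hcfg hφ hI αQ).C' (case5kB hf hd hF hC hS hcfg hφ hI αQ) f (case5R₁ hC hS hcfg) αφ αI αQ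
      (case5E₂ hf hd hF hC hS hcfg hφ hI αQ).P' δ₃)
    (hT : ∀ T, E₃.C'.Troubled T →
      (case5C₁ hcfg).Troubled ((case5E₁ hf hd hF hC hS hcfg hφ hI αQ).ι ((case5E₂ hf hd hF hC hS hcfg hφ hI αQ).ι
        (E₃.ι T)))) :
    C.StepGoal f R αφ αI αQ := by
  classical
  set E₁ := case5E₁ hf hd hF hC hS hcfg hφ hI αQ with hE₁
  set E₂ := case5E₂ hf hd hF hC hS hcfg hφ hI αQ with hE₂
  have hx := case5_free_x hC hcfg
  have hxp := case5_unprot_x hS hcfg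
  -- troubled gates inject into the troubled gates of `C₁`, which lost `G`
  have hpot : (E₃.C'.troubledCount : ℝ) + 1 ≤ C.troubledCount := by
    unfold troubledCount
    set T₃ := univ.filter fun k => E₃.C'.Troubled k with hT₃
    set T₀ := univ.filter fun k => C.Troubled k with hT₀
    have hGT : G ∈ T₀ := by rw [hT₀, mem_filter]; exact ⟨mem_univ _, hcfg.troubled⟩
    let φ : Fin E₃.C'.m → Fin C.m := fun T => E₁.ι (E₂.ι (E₃.ι T))
    have hinj : Set.InjOn φ T₃ := fun a _ b _ h => E₃.ι_injective (E₂.ι_injective (E₁.ι_injective h))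
    have hmaps : ∀ T ∈ T₃, φ T ∈ T₀.erase G := by
      intro T hTm
      rw [hT₃, mem_filter] at hTm
      have h1 := hT T hTm.2
      rw [mem_erase, hT₀, mem_filter]
      refine ⟨fun hG => ?_, mem_univ _, troubled_of_troubled_substConst (C := C) h1⟩
      change (case5C₁ hcfg).Troubled (φ T) at h1
      rw [hG] at h1
      exact not_troubled_of_reads_const (case5C₁_arg_G hcfg) h1
    have h1 := card_le_card_of_injOn φ hmaps hinj
    rw [card_erase_of_mem hGT] at h1
    have h2 := card_pos.mpr ⟨G, hGT⟩
    have : T₃.card + 1 ≤ T₀.card := by omega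
    exact_mod_cast this
  -- influential inputs
  have hxinf : x ∈ C.influential R := C.mem_influential_of_reads R hcfg.arg_G_x
  have hinf₁ : (((case5C₁ hcfg).influential (case5R₁ hC hS hcfg)).card : ℝ) + 1 ≤ (C.influential R).card := by
    have h1 := card_le_card (C.influential_substConst_assignFree_subset hx hxp (case5c hcfg) (finTwoEquiv (case5c hcfg)))
    have h3 := card_erase_of_mem hxinf
    have h4 := card_pos.mpr ⟨x, hxinf⟩
    have : ((case5C₁ hcfg).influential (case5R₁ hC hS hcfg)).card + 1 ≤ (C.influential R).card := by
      change ((C.substConst x (finTwoEquiv (case5c hcfg))).influential (R.assignFree x (case5c hcfg) hx hxp)).card + 1 ≤ _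
      omega
    exact_mod_cast this
  have hinf₃ : ((E₃.C'.influential (case5R₁ hC hS hcfg)).card : ℝ) ≤ ((case5C₁ hcfg).influential (case5R₁ hC hS hcfg)).card := by
    have h1 := E₃.influential_subset (case5R₁ hC hS hcfg)
    have h2 := E₂.influential_subset (case5R₁ hC hS hcfg)
    have h3 := E₁.influential_subset (case5R₁ hC hS hcfg)
    exact_mod_cast card_le_card (h1.trans (h2.trans h3))
  -- gates
  have hm : (E₃.C'.m : ℝ) + 3 = C.m := by
    have h1 : E₁.C'.m + 1 = C.m := E₁.m_add_one
    have h2 : E₂.C'.m + 1 = E₁.C'.m := E₂.m_add_one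
    have h3 : E₃.C'.m + 1 = E₂.C'.m := E₃.m_add_one
    have : E₃.C'.m + 3 = C.m := by omega
    exact_mod_cast this
  have hq : ((case5R₁ hC hS hcfg).quadCount : ℝ) = R.quadCount := by
    show ((R.assignFree x (case5c hcfg) hx hxp).quadCount : ℝ) = _
    rw [RdqSource.quadCount_assignFree]
  have hdim : (case5R₁ hC hS hcfg).dim + 1 = R.dim := RdqSource.dim_assignFree hx hxp
  -- assemble with the empty packing
  refine Or.inr ⟨1, le_rfl, by norm_num, E₃.C', case5R₁ hC hS hcfg, ∅, E₃.fair, E₃.computes, E₃.C'.isPacking_empty, hdim, ?_⟩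
  rw [Nat.cast_one, mul_one]
  have hδ := liYangDelta_le_three αφ αI αQ
  unfold measure potential
  rw [hq]
  simp only [card_empty, Nat.cast_zero, sub_zero]
  nlinarith [mul_le_mul_of_nonneg_left hinf₁ hI, mul_le_mul_of_nonneg_left hinf₃ hI, mul_le_mul_of_nonneg_left hpot hφ]


end MainOf

/-- **Case 5.4 of the proof of Thm. 4.1 (dispatcher).** [cite: LiYang2022, §4.1 (Case 5.4)] -/
theorem LiYang2022_case5_4_holds_aux (hf : IsAffineDisperser f d) (hd : 2 * d + 2 < R.dim) (hF : C.Fair)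
    (hC : C.ComputesRestr f R) (hS : C.Standing R) (hcfg : C.Case5Config G x y B C' D aX aB aC aD)
    (hφ0 : 0 < αφ) (hφ : αφ < 1 / 2) (hI0 : 0 < αI) (αQ : ℝ)
    (hBC : B ≠ C') (hnDB : ¬ C.Reads D B) (hnBD : ¬ C.Reads B D)
    -- the three leaves needing new substitutions, as hypotheses (named facts below)
    (hF3 : ∀ (E : Fin C.m) (aE : Fin 2) (t u : Fin n), ¬ IsAndOp (C.op B) → C.arg B aB.rev = .var t →
      IsAndOp (C.op E) → C.arg E aE = .gate D → C.arg E aE.rev = .gate B → C.fanout (.gate E) = 1 →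
      C.arg D aD.rev = .var u → C.fanout (.var t) + C.fanout (.gate B) = 3 → C.fanout (.var u) = 2 → C.fanout (.gate D) = 1 →
      C.StepGoal f R αφ αI αQ)
    (hF7 : ∀ (E : Fin C.m) (aE : Fin 2) (t z : Fin n), ¬ IsAndOp (C.op B) → C.arg B aB.rev = .var t →
      IsAndOp (C.op E) → C.arg E aE = .gate B → C.arg E aE.rev = .var z → C.fanout (.gate B) = 2 →
      C.StepGoal f R αφ αI αQ)
    (hF6 : ∀ (E : Fin C.m) (aE : Fin 2) (u : Fin n), ¬ IsAndOp (C.op D) → C.arg D aD.rev = .var u → ¬ R.Protected u →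
      C.fanout (.var u) = 1 → C.fanout (.gate D) = 2 → IsAndOp (C.op E) → C.arg E aE = .gate D → C.fanout (.gate E) = 1 →
      ((∃ t, C.arg E aE.rev = .var t ∧ C.fanout (.var t) = 2) ∨
        (C.arg E aE.rev = .gate B ∧ ¬ IsAndOp (C.op B) ∧ ∃ t, C.arg B aB.rev = .var t ∧ C.fanout (.var t) + C.fanout (.gate B) = 3)) →
      C.StepGoal f R αφ αI αQ)
    (hF5 : ∀ (E : Fin C.m) (aE : Fin 2) (u : Fin n), ¬ IsAndOp (C.op D) → C.arg D aD.rev = .var u → R.Protected u →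
      C.fanout (.var u) = 1 → C.fanout (.gate D) = 2 → IsAndOp (C.op E) → C.arg E aE = .gate D → C.fanout (.gate E) = 1 →
      ((∃ t, C.arg E aE.rev = .var t ∧ C.fanout (.var t) = 2) ∨ C.arg E aE.rev = .gate B) →
      C.StepGoal f R αφ αI αQ) :
    C.StepGoal f R αφ αI αQ := by
  classical
  have hφ' := hφ0.le
  have hI' := hI0.le
  have hN := hS.normalized.1
  have hGK := hcfg.G_not_mem
  have hDK : D ∉ C.xorPart := fun hDK => hGK (C.mem_of_arg_eq D hDK aD G hcfg.arg_D)
  have hxp := case5_unprot_x hS hcfg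
  have hyp := case5_unprot_y hS hcfg
  -- the other wires `I` of `D` and `J` of `B`
  have hIG := case5_arg_D_rev_ne_G hS hcfg
  have hIx := case5_D_not_x hS hcfg aD.rev
  have hIy := case5_D_not_y hS hcfg aD.rev
  have hIB : C.arg D aD.rev ≠ .gate B := fun h => hnBD ⟨aD.rev, h⟩
  have hID : C.arg D aD.rev ≠ .gate D := C.arg_ne_self_of_not_mem hDK _
  have hIc : ∀ b, C.arg D aD.rev ≠ .const b := fun b => hN.arg_ne_const D _ b
  have hJx : C.arg B aB.rev ≠ .var x := by
    intro h
    have e : ∀ a', C.arg B a' = .var x := fun a' => by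
      rcases fin2_eq_or_eq_rev aB a' with h' | h'
      · rw [h']; exact hcfg.arg_B
      · rw [h']; exact h
    exact hN.arg_zero_ne_arg_one B (by rw [e 0, e 1])
  have hJy : C.arg B aB.rev ≠ .var y := case5_B_not_y hcfg hBC aB.rev
  have hJG : C.arg B aB.rev ≠ .gate G := by
    intro h; have := two_le_fanout h hcfg.arg_D (case5_B_ne_D hS hcfg); have := hcfg.fanout_G; omega
  have hJD : C.arg B aB.rev ≠ .gate D := fun h => hnDB ⟨aB.rev, h⟩
  have hJc : ∀ b, C.arg B aB.rev ≠ .const b := fun b => hN.arg_ne_const B _ b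
  have hGx' : C.arg G aX.rev.rev = .var x := by rw [Fin.rev_rev]; exact hcfg.arg_G_x
  -- (1) an ∧-gate `E` reads the `1`-gate `B` and a variable `z ≠ y`: two constants (Case 5.4.2, `B` a `1`-gate)
  by_cases hAlt : ∃ (E : Fin C.m) (aE : Fin 2) (z : Fin n), IsAndOp (C.op E) ∧ C.arg E aE = .gate B ∧
      C.arg E aE.rev = .var z ∧ C.fanout (.gate B) = 1 ∧ z ≠ y
  · obtain ⟨E, aE, z, hEand, hEB, hEz, hB1, hzy⟩ := hAlt
    have hEK : E ∉ C.xorPart := C.not_mem_xorPart_of_isAndOp hEand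
    have hEG : E ≠ G := by
      intro h; rw [h] at hEB
      rcases fin2_eq_or_eq_rev aX aE with e | e
      · rw [e, hcfg.arg_G_x] at hEB; cases hEB
      · rw [e, hcfg.arg_G_y] at hEB; cases hEB
    have hEB' : E ≠ B := fun h => by rw [h] at hEB hEK; exact C.arg_ne_self_of_not_mem hEK _ hEB
    have hxz : x ≠ z := by
      intro h; rw [← h] at hEz
      rcases case5_reader_x hcfg hEz with h' | h'
      · exact hEG h'
      · exact hEB' h'
    have hEB'' : C.arg E aE.rev.rev = .gate B := by rw [Fin.rev_rev]; exact hEB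
    exact stepGoal_two_consts hf hd hF hC hS hφ' (by linarith) hI' αQ hcfg.and_G hcfg.arg_G_y hGx' hEand hEz hEB''
      hcfg.arg_B hB1 hcfg.fanout_x hcfg.x_ne_y hxz (fun h => hzy h.symm) hEG hcfg.B_ne_G
  -- (2) `B` is ∧-type reading `x` and a variable `t`: two constants (Case 5.4.1.1.2)
  by_cases hAlt₂ : IsAndOp (C.op B) ∧ ∃ t, C.arg B aB.rev = .var t
  · obtain ⟨hBand, t, hBt⟩ := hAlt₂
    have hxt : x ≠ t := fun h => hJx (by rw [hBt, h])
    have hyt : y ≠ t := fun h => hJy (by rw [hBt, h])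
    have hBx' : C.arg B aB.rev.rev = .var x := by rw [Fin.rev_rev]; exact hcfg.arg_B
    exact stepGoal_two_consts_readers hf hd hF hC hS hφ' (by linarith) hI' αQ hcfg.and_G hcfg.arg_G_y hGx' hBand hBt hBx'
      hcfg.fanout_x hcfg.x_ne_y hxt hyt hcfg.B_ne_G
  -- (3) `D` is ∧-type reading `G` and a variable, with two readers (Case 5.4.1.2)
  by_cases hAlt₄ : IsAndOp (C.op D) ∧ (∃ z, C.arg D aD.rev = .var z) ∧ 2 ≤ C.fanout (.gate D)
  · obtain ⟨hDand, ⟨z, hDz⟩, hD2⟩ := hAlt₄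
    have hzx : z ≠ x := fun h => hIx (by rw [hDz, h])
    have hzy : z ≠ y := fun h => hIy (by rw [hDz, h])
    obtain ⟨F₁, a₁, hF₁⟩ := exists_reader_of_fanout_pos (D := C) (by omega : 0 < C.fanout (.gate D))
    have hF₁1 : (univ.filter fun a : Fin 2 => C.arg F₁ a = .gate D).card ≤ 1 := by
      rw [card_le_one]
      intro a ha b hb
      rw [mem_filter] at ha hb
      by_contra hab
      have e : ∀ a', C.arg F₁ a' = .gate D := fun a' => by
        rcases fin2_eq_or_eq_rev a a' with h' | h'
        · rw [h']; exact ha.2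
        · have : b = a.rev := by
            rcases fin2_eq_or_eq_rev a b with h'' | h''
            · exact absurd h''.symm hab
            · exact h''
          rw [h', ← this]; exact hb.2
      exact hN.arg_zero_ne_arg_one F₁ (by rw [e 0, e 1])
    obtain ⟨F₂, a₂, hF₂₁, hF₂⟩ := exists_reader_ne hD2 hF₁1
    exact stepGoal_trivialize_mid hf hd hF hC hS hφ' hI' αQ hcfg.arg_G_x hcfg.arg_G_y hcfg.fanout_x hcfg.fanout_y
      hcfg.fanout_G hDand hcfg.arg_D hDz hzx hzy hF₁ hF₂ (fun h => hF₂₁ h.symm)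
  -- (4) the reader `E` of the `1`-gate `D` is an ∧-type `1`-gate reading `D` and a variable `t` (Case 5.4.1.1.1)
  by_cases hAlt₃ : ∃ (E : Fin C.m) (aE : Fin 2) (t u : Fin n), IsAndOp (C.op E) ∧ C.arg E aE = .gate D ∧
      C.arg E aE.rev = .var t ∧ C.fanout (.gate E) = 1 ∧ C.fanout (.gate D) = 1 ∧ C.arg D aD.rev = .var u ∧
      C.fanout (.var u) ≤ 2 ∧ t ≠ u ∧ t ≠ x ∧ t ≠ y
  · obtain ⟨E, aE, t, u, hEand, hED, hEt, hE1, hD1, hDu, hu2, htu, htx, hty⟩ := hAlt₃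
    obtain ⟨H, aH, hHE⟩ := exists_reader_of_fanout_pos (D := C) (by omega : 0 < C.fanout (.gate E))
    exact stepGoal_trivialize_reader hf hd hF hC hS hφ' hI' αQ hcfg.arg_G_x hcfg.arg_G_y (le_of_eq hcfg.fanout_x)
      (le_of_eq hcfg.fanout_y) hcfg.fanout_G hcfg.arg_D hDu hu2 hD1 hEand hED hEt hE1 htx hty htu hHE hcfg.and_G
  -- (5) the main strategy and its analysis
  have hkD : (case5E₁ hf hd hF hC hS hcfg hφ' hI' αQ).ι (case5kD hf hd hF hC hS hcfg hφ' hI' αQ) = D := case5kD_spec hf hd hF hC hS hcfg hφ' hI' αQ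
  have hkB₁ : (case5E₁ hf hd hF hC hS hcfg hφ' hI' αQ).ι (case5kB₁ hf hd hF hC hS hcfg hφ' hI' αQ) = B := case5kB₁_spec hf hd hF hC hS hcfg hφ' hI' αQ
  have hkB : (case5E₂ hf hd hF hC hS hcfg hφ' hI' αQ).ι (case5kB hf hd hF hC hS hcfg hφ' hI' αQ) = (case5kB₁ hf hd hF hC hS hcfg hφ' hI' αQ) := case5kB_spec hf hd hF hC hS hcfg hφ' hI' αQ
  have hd₁ : 2 * d + 2 ≤ (case5R₁ hC hS hcfg).dim := (case5R₁_dim hC hS hcfg).mpr hd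
  have hrepl₁ : (case5E₁ hf hd hF hC hS hcfg hφ' hI' αQ).repl = .const ((case5C₁ hcfg).liveFn G aX (case5b hcfg) false) := case5E₁_repl hf hd hF hC hS hcfg hφ' hI' αQ
  -- wires of `C₁`
  have hC₁var : ∀ {k : Fin C.m} {a : Fin 2} {v : Fin n}, (case5C₁ hcfg).arg k a = .var v ↔ C.arg k a = .var v ∧ v ≠ x := by
    intro k a v
    rw [case5C₁_arg]
    cases hka : C.arg k a with
    | const c => exact ⟨(fun h => by cases h), fun h => by cases h.1⟩
    | var i =>
      by_cases hix : i = x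
      · rw [hix, Node.substConst_var_self]
        exact ⟨(fun h => by cases h), fun h => absurd (Node.var.inj h.1).symm h.2⟩
      · rw [Node.substConst_var_of_ne hix]
        exact ⟨(fun h => ⟨h, by cases h; exact hix⟩), fun h => h.1⟩
    | gate g => exact ⟨(fun h => by cases h), fun h => by cases h.1⟩
  have hC₁gate : ∀ {k : Fin C.m} {a : Fin 2} {g : Fin C.m}, (case5C₁ hcfg).arg k a = .gate g ↔ C.arg k a = .gate g := by
    intro k a g
    rw [case5C₁_arg]
    cases hka : C.arg k a with
    | const c => exact ⟨(fun h => by cases h), fun h => by cases h⟩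
    | var i =>
      by_cases hix : i = x
      · rw [hix, Node.substConst_var_self]; exact ⟨(fun h => by cases h), fun h => by cases h⟩
      · rw [Node.substConst_var_of_ne hix]
    | gate g' => exact Iff.rfl
  have hC₁const : ∀ {k : Fin C.m} {a : Fin 2} {b : Bool}, (case5C₁ hcfg).arg k a = .const b → C.arg k a = .var x := by
    intro k a b h
    rw [case5C₁_arg] at h
    cases hka : C.arg k a with
    | const c => exact absurd hka (hN.arg_ne_const k a c)
    | var i =>
      rw [hka] at h
      by_cases hix : i = x
      · rw [hix]
      · rw [Node.substConst_var_of_ne hix] at h; cases h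
    | gate g' => rw [hka] at h; cases h
  -- wires of `(case5kD hf hd hF hC hS hcfg hφ' hI' αQ)`, `(case5kB₁ hf hd hF hC hS hcfg hφ' hI' αQ)`, `(case5kB hf hd hF hC hS hcfg hφ' hI' αQ)`
  have hkDc := case5_arg_kD hf hd hF hC hS hcfg hφ' hI' αQ
  have hkDrev : (case5E₁ hf hd hF hC hS hcfg hφ' hI' αQ).C'.arg (case5kD hf hd hF hC hS hcfg hφ' hI' αQ) aD.rev = (case5E₁ hf hd hF hC hS hcfg hφ' hI' αQ).pull (C.arg D aD.rev) := case5_arg_kD_rev hf hd hF hC hS hcfg hφ' hI' αQ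
  have hkB₁c := case5_arg_kB₁ hf hd hF hC hS hcfg hφ' hI' αQ
  have hkBc := case5_arg_kB hf hd hF hC hS hcfg hφ' hI' αQ
  have hB₁rev : (case5E₁ hf hd hF hC hS hcfg hφ' hI' αQ).C'.arg (case5kB₁ hf hd hF hC hS hcfg hφ' hI' αQ) aB.rev = (case5E₁ hf hd hF hC hS hcfg hφ' hI' αQ).pull ((case5C₁ hcfg).arg B aB.rev) := by
    rw [(case5E₁ hf hd hF hC hS hcfg hφ' hI' αQ).arg_eq', hkB₁, if_neg (fun h => hJG (hC₁gate.mp h))]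
  have hJ₁D : (case5E₁ hf hd hF hC hS hcfg hφ' hI' αQ).pull ((case5C₁ hcfg).arg B aB.rev) ≠ .gate (case5kD hf hd hF hC hS hcfg hφ' hI' αQ) := by
    intro h
    have := congrArg (case5E₁ hf hd hF hC hS hcfg hφ' hI' αQ).embed h
    rw [(case5E₁ hf hd hF hC hS hcfg hφ' hI' αQ).embed_pull (fun h' => hJG (hC₁gate.mp h'))] at this
    exact hJD (hC₁gate.mp (this.trans (by show Node.gate ((case5E₁ hf hd hF hC hS hcfg hφ' hI' αQ).ι (case5kD hf hd hF hC hS hcfg hφ' hI' αQ)) = _; rw [hkD])))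
  have hB₂rev : (case5E₂ hf hd hF hC hS hcfg hφ' hI' αQ).C'.arg (case5kB hf hd hF hC hS hcfg hφ' hI' αQ) aB.rev = (case5E₂ hf hd hF hC hS hcfg hφ' hI' αQ).pull ((case5E₁ hf hd hF hC hS hcfg hφ' hI' αQ).pull ((case5C₁ hcfg).arg B aB.rev)) := by
    rw [(case5E₂ hf hd hF hC hS hcfg hφ' hI' αQ).arg_eq', hkB, hB₁rev, if_neg hJ₁D]
  have hrepl₂ := case5E₂_repl_cases hf hd hF hC hS hcfg hφ' hI' αQ
  -- `C'` along the chain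
  obtain ⟨kC₁, hkC₁⟩ := (case5E₁ hf hd hF hC hS hcfg hφ' hI' αQ).ι_surj C' hcfg.C_ne_G
  have hkC₁D : kC₁ ≠ (case5kD hf hd hF hC hS hcfg hφ' hI' αQ) := by
    intro h; have := congrArg (case5E₁ hf hd hF hC hS hcfg hφ' hI' αQ).ι h; rw [hkC₁, hkD] at this; exact case5_C_ne_D hS hcfg this
  obtain ⟨kC₂, hkC₂⟩ := (case5E₂ hf hd hF hC hS hcfg hφ' hI' αQ).ι_surj kC₁ hkC₁D
  have hkC₂B : kC₂ ≠ (case5kB hf hd hF hC hS hcfg hφ' hI' αQ) := by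
    intro h; have := congrArg (case5E₂ hf hd hF hC hS hcfg hφ' hI' αQ).ι h; rw [hkC₂, hkB] at this
    have := congrArg (case5E₁ hf hd hF hC hS hcfg hφ' hI' αQ).ι this; rw [hkC₁, hkB₁] at this; exact hBC this.symm
  obtain ⟨kC₃, hkC₃⟩ := (case5E₃ hf hd hF hC hS hcfg hφ' hI' αQ).ι_surj kC₂ hkC₂B
  have hkC₁y : (case5E₁ hf hd hF hC hS hcfg hφ' hI' αQ).C'.arg kC₁ aC = .var y := by
    rw [(case5E₁ hf hd hF hC hS hcfg hφ' hI' αQ).arg_eq_var_iff, hkC₁]; left; exact hC₁var.mpr ⟨hcfg.arg_C, fun h => hcfg.x_ne_y h.symm⟩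
  have hkC₂y : (case5E₂ hf hd hF hC hS hcfg hφ' hI' αQ).C'.arg kC₂ aC = .var y := by rw [(case5E₂ hf hd hF hC hS hcfg hφ' hI' αQ).arg_eq_var_iff, hkC₂]; exact Or.inl hkC₁y
  have hkC₃y : (case5E₃ hf hd hF hC hS hcfg hφ' hI' αQ).C'.arg kC₃ aC = .var y := by rw [(case5E₃ hf hd hF hC hS hcfg hφ' hI' αQ).arg_eq_var_iff, hkC₃]; exact Or.inl hkC₂y
  -- out-degrees after step 1
  have hfanD₁ : (case5E₁ hf hd hF hC hS hcfg hφ' hI' αQ).C'.fanout (.gate (case5kD hf hd hF hC hS hcfg hφ' hI' αQ)) = C.fanout (.gate D) := by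
    rw [(case5E₁ hf hd hF hC hS hcfg hφ' hI' αQ).fanout_gate_eq (fun a h => ?_) (by rw [hrepl₁]; exact fun h => by cases h), hkD, C.fanout_substConst_gate]
    rw [hkD] at h
    rcases fin2_eq_or_eq_rev aX a with e | e
    · rw [e, case5C₁_arg_G] at h; cases h
    · rw [e, case5C₁_arg_G_rev] at h; cases h
  have hfanB₁ : (case5E₁ hf hd hF hC hS hcfg hφ' hI' αQ).C'.fanout (.gate (case5kB₁ hf hd hF hC hS hcfg hφ' hI' αQ)) = C.fanout (.gate B) := by
    rw [(case5E₁ hf hd hF hC hS hcfg hφ' hI' αQ).fanout_gate_eq (fun a h => ?_) (by rw [hrepl₁]; exact fun h => by cases h), hkB₁, C.fanout_substConst_gate]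
    rw [hkB₁] at h
    rcases fin2_eq_or_eq_rev aX a with e | e
    · rw [e, case5C₁_arg_G] at h; cases h
    · rw [e, case5C₁_arg_G_rev] at h; cases h
  have hfanu₁ : ∀ {u : Fin n}, u ≠ x → u ≠ y → (case5E₁ hf hd hF hC hS hcfg hφ' hI' αQ).C'.fanout (.var u) = C.fanout (.var u) := by
    intro u hux huy
    rw [(case5E₁ hf hd hF hC hS hcfg hφ' hI' αQ).fanout_var_eq (fun a h => ?_) (by rw [hrepl₁]; exact fun h => by cases h), C.fanout_substConst_var_of_ne x _ hux]
    rcases fin2_eq_or_eq_rev aX a with e | e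
    · rw [e, case5C₁_arg_G] at h; cases h
    · rw [e, case5C₁_arg_G_rev] at h; cases h; exact huy rfl
  -- a gate of `(case5E₁ hf hd hF hC hS hcfg hφ' hI' αQ).C'` other than `(case5kB₁ hf hd hF hC hS hcfg hφ' hI' αQ)` reading the constant is not ... (we only need: troubled gates read no constant)
  -- STEP 2: a new troubled gate forces the configuration of Cases 5.4.1.3/5.4.1.4
  have hstep2 : ∀ T, (case5E₂ hf hd hF hC hS hcfg hφ' hI' αQ).C'.Troubled T → ¬ (case5E₁ hf hd hF hC hS hcfg hφ' hI' αQ).C'.Troubled ((case5E₂ hf hd hF hC hS hcfg hφ' hI' αQ).ι T) →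
      ∃ (u : Fin n) (aE : Fin 2) (t : Fin n), C.arg D aD.rev = .var u ∧ (case5E₂ hf hd hF hC hS hcfg hφ' hI' αQ).repl = .var u ∧ C.fanout (.var u) = 1 ∧
        C.fanout (.gate D) = 2 ∧ ¬ IsAndOp (C.op D) ∧ IsAndOp (C.op ((case5E₁ hf hd hF hC hS hcfg hφ' hI' αQ).ι ((case5E₂ hf hd hF hC hS hcfg hφ' hI' αQ).ι T))) ∧
        C.arg ((case5E₁ hf hd hF hC hS hcfg hφ' hI' αQ).ι ((case5E₂ hf hd hF hC hS hcfg hφ' hI' αQ).ι T)) aE = .gate D ∧ C.arg ((case5E₁ hf hd hF hC hS hcfg hφ' hI' αQ).ι ((case5E₂ hf hd hF hC hS hcfg hφ' hI' αQ).ι T)) aE.rev = .var t ∧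
        C.fanout (.gate ((case5E₁ hf hd hF hC hS hcfg hφ' hI' αQ).ι ((case5E₂ hf hd hF hC hS hcfg hφ' hI' αQ).ι T))) = 1 ∧ C.fanout (.var t) = 2 := by
    intro T hT' hT
    obtain ⟨a, ha⟩ := (case5E₂ hf hd hF hC hS hcfg hφ' hI' αQ).causedBy_of_new_troubled T hT' hT
    rcases fin2_eq_or_eq_rev aD a with e | e
    · rw [e, hkDc] at ha; exact absurd ha not_causedBy_const
    rw [e, hkDrev] at ha
    -- common: the images of `T`
    have hT₀G : ∀ a', (case5C₁ hcfg).arg ((case5E₁ hf hd hF hC hS hcfg hφ' hI' αQ).ι ((case5E₂ hf hd hF hC hS hcfg hφ' hI' αQ).ι T)) a' ≠ .gate G := by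
      intro a' h
      have hread := hC₁gate.mp h
      -- readers of `G`: only `D`
      have := two_le_fanout hread hcfg.arg_D (fun h' => (case5E₂ hf hd hF hC hS hcfg hφ' hI' αQ).ι_ne T ((case5E₁ hf hd hF hC hS hcfg hφ' hI' αQ).ι_injective (h'.trans hkD.symm)))
      have := hcfg.fanout_G; omega
    have hfanT₁ : (case5E₁ hf hd hF hC hS hcfg hφ' hI' αQ).C'.fanout (.gate ((case5E₂ hf hd hF hC hS hcfg hφ' hI' αQ).ι T)) = C.fanout (.gate ((case5E₁ hf hd hF hC hS hcfg hφ' hI' αQ).ι ((case5E₂ hf hd hF hC hS hcfg hφ' hI' αQ).ι T))) := by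
      rw [(case5E₁ hf hd hF hC hS hcfg hφ' hI' αQ).fanout_gate_eq (fun a' h => ?_) (by rw [hrepl₁]; exact fun h => by cases h), C.fanout_substConst_gate]
      rcases fin2_eq_or_eq_rev aX a' with e' | e'
      · rw [e', case5C₁_arg_G] at h; cases h
      · rw [e', case5C₁_arg_G_rev] at h; cases h
    cases hI : C.arg D aD.rev with
    | const b => exact absurd hI (hIc b)
    | gate gI =>
      exfalso
      rw [hI] at ha
      have hgIG : gI ≠ G := fun h => hIG (by rw [hI, h])
      have hgID : gI ≠ D := fun h => hID (by rw [hI, h])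
      obtain ⟨kI₁, hkI₁⟩ := (case5E₁ hf hd hF hC hS hcfg hφ' hI' αQ).ι_surj gI hgIG
      have hpI : (case5E₁ hf hd hF hC hS hcfg hφ' hI' αQ).pull (.gate gI) = .gate kI₁ := by rw [← hkI₁]; exact (case5E₁ hf hd hF hC hS hcfg hφ' hI' αQ).pull_ι kI₁
      rw [hpI] at ha
      rcases ha with ha | ⟨z, hz, -⟩
      swap; · cases hz
      have hTι : (case5E₂ hf hd hF hC hS hcfg hφ' hI' αQ).ι T = kI₁ := (Node.gate.inj ha).symm
      have hgI_G : ∀ a', C.arg gI a' ≠ .gate G := by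
        intro a' h
        have := two_le_fanout h hcfg.arg_D hgID
        have := hcfg.fanout_G; omega
      have hgI_D : ∀ a', C.arg gI a' ≠ .gate D := fun a' h => not_reads_of_reads hDK ⟨a', h⟩ ⟨aD.rev, hI⟩
      have hkI₁wires : ∀ a', (case5C₁ hcfg).arg ((case5E₁ hf hd hF hC hS hcfg hφ' hI' αQ).ι kI₁) a' ≠ .gate G := by
        intro a'; rw [hkI₁]; exact fun h => hgI_G a' (hC₁gate.mp h)
      have hkI₁D : ∀ a', (case5E₁ hf hd hF hC hS hcfg hφ' hI' αQ).C'.arg kI₁ a' ≠ .gate (case5kD hf hd hF hC hS hcfg hφ' hI' αQ) := by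
        intro a' h
        rw [(case5E₁ hf hd hF hC hS hcfg hφ' hI' αQ).arg_eq_gate_iff, hkI₁, hkD] at h
        rcases h with h | ⟨h, -⟩
        · exact hgI_D a' (hC₁gate.mp h)
        · exact hgI_G a' (hC₁gate.mp h)
      have hfanI₁ : (case5E₁ hf hd hF hC hS hcfg hφ' hI' αQ).C'.fanout (.gate kI₁) = C.fanout (.gate gI) := by
        rw [(case5E₁ hf hd hF hC hS hcfg hφ' hI' αQ).fanout_gate_eq (fun a' h => ?_) (by rw [hrepl₁]; exact fun h => by cases h), hkI₁, C.fanout_substConst_gate]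
        rw [hkI₁] at h
        rcases fin2_eq_or_eq_rev aX a' with e' | e'
        · rw [e', case5C₁_arg_G] at h; cases h
        · rw [e', case5C₁_arg_G_rev] at h; cases h
      have hDreads : 1 ≤ C.fanout (.gate gI) := one_le_fanout_of_arg_eq hI
      have hcountI : (univ.filter fun a' : Fin 2 => (case5E₁ hf hd hF hC hS hcfg hφ' hI' αQ).C'.arg (case5kD hf hd hF hC hS hcfg hφ' hI' αQ) a' = .gate kI₁).card = 1 := by
        rw [card_eq_one]; refine ⟨aD.rev, ?_⟩; ext a'
        rw [mem_filter, mem_singleton]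
        constructor
        · intro h
          rcases fin2_eq_or_eq_rev aD a' with e' | e'
          · have := h.2; rw [e', hkDc] at this; cases this
          · exact e'
        · rintro rfl; exact ⟨mem_univ _, by rw [hkDrev, hI, hpI]⟩
      obtain ⟨hand', hf1', x', y', hxy', hr', hx', hy'⟩ := hT'
      -- variable wires of `T` are `2`-variable wires of `gI` in `C`
      have hvarT : ∀ a' v, (case5E₂ hf hd hF hC hS hcfg hφ' hI' αQ).C'.arg T a' = .var v → C.arg gI a' = .var v ∧ v ≠ x ∧ v ≠ y ∧
          (case5E₂ hf hd hF hC hS hcfg hφ' hI' αQ).C'.fanout (.var v) = C.fanout (.var v) := by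
        intro a' v hv
        have hv₁ : (case5E₁ hf hd hF hC hS hcfg hφ' hI' αQ).C'.arg kI₁ a' = .var v := by
          rw [(case5E₂ hf hd hF hC hS hcfg hφ' hI' αQ).arg_eq_var_iff, hTι] at hv
          rcases hv with hv | ⟨hv', -⟩
          · exact hv
          · exact absurd hv' (hkI₁D a')
        have hv₀ : C.arg gI a' = .var v ∧ v ≠ x := by
          rw [(case5E₁ hf hd hF hC hS hcfg hφ' hI' αQ).arg_eq_var_iff, hkI₁] at hv₁
          rcases hv₁ with hv₁ | ⟨h, -⟩
          · exact hC₁var.mp hv₁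
          · exact absurd (hC₁gate.mp h) (hgI_G a')
        have hvy : v ≠ y := by
          intro h; rw [h] at hv₀
          rcases case5_reader_y hcfg hv₀.1 with h' | h'
          · exact hgIG h'
          · -- `gI = C'`: then `T` reads `y`
            rw [h] at hv
            exact case5_not_troubled_of_reads_y₂ hf hd hF hC hS hcfg hφ' hI' αQ hv ⟨hand', hf1', x', y', hxy', hr', hx', hy'⟩
        have hfv₁ : (case5E₁ hf hd hF hC hS hcfg hφ' hI' αQ).C'.fanout (.var v) = C.fanout (.var v) := hfanu₁ hv₀.2 hvy
        have hfv₂ : (case5E₂ hf hd hF hC hS hcfg hφ' hI' αQ).C'.fanout (.var v) = (case5E₁ hf hd hF hC hS hcfg hφ' hI' αQ).C'.fanout (.var v) := by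
          refine (case5E₂ hf hd hF hC hS hcfg hφ' hI' αQ).fanout_var_eq (fun a'' h => ?_) (fun h => ?_)
          · rcases fin2_eq_or_eq_rev aD a'' with e' | e'
            · rw [e', hkDc] at h; cases h
            · rw [e', hkDrev, hI, hpI] at h; cases h
          · rcases hrepl₂ with ⟨b₂, hb₂⟩ | hr₂
            · rw [hb₂] at h; cases h
            · rw [hr₂, hI, hpI] at h; cases h
        exact ⟨hv₀.1, hv₀.2, hvy, hfv₂.trans hfv₁⟩
      have handC : IsAndOp (C.op gI) := by
        have := ((case5E₂ hf hd hF hC hS hcfg hφ' hI' αQ).isAndOp_iff T).mp hand'; rw [hTι] at this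
        have := ((case5E₁ hf hd hF hC hS hcfg hφ' hI' αQ).isAndOp_iff kI₁).mp this; rwa [hkI₁] at this
      obtain ⟨v₀, hv₀⟩ := Troubled.arg_isVar ⟨hand', hf1', x', y', hxy', hr', hx', hy'⟩ 0
      have hfv₀ := Troubled.fanout_eq_two ⟨hand', hf1', x', y', hxy', hr', hx', hy'⟩ hv₀
      obtain ⟨hC₀, hv₀x, hv₀y, hfeq₀⟩ := hvarT 0 v₀ hv₀
      rw [hfeq₀] at hfv₀
      have h3 := hS.and_fanout_le v₀ gI 0 hC₀ handC
      -- so `fanout_C(gI) = 1`: then nothing changed for `gI` from `(case5E₁ hf hd hF hC hS hcfg hφ' hI' αQ)` to `(case5E₂ hf hd hF hC hS hcfg hφ' hI' αQ)` except (when `D` passes it) its fanout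
      have hgI1 : C.fanout (.gate gI) = 1 := by omega
      rcases hrepl₂ with ⟨b₂, hb₂⟩ | hr₂
      · -- `D` trivialized: `fanout(T) + 1 = fanout(gI) = 1`, impossible with `fanout(T) = 1`
        have h1 := (case5E₂ hf hd hF hC hS hcfg hφ' hI' αQ).fanout_gate_add (k' := T) (by rw [hb₂]; exact fun h => by cases h)
        rw [hTι, hfanI₁, hcountI] at h1
        omega
      · -- `D` degenerate: `fanout(T) + 1 = fanout(gI) + fanout(D)`, so `fanout(D) = 1`, and `T` was troubled already
        have hr₂' : (case5E₂ hf hd hF hC hS hcfg hφ' hI' αQ).repl = .gate kI₁ := by rw [hr₂, hI, hpI]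
        have h1 := (case5E₂ hf hd hF hC hS hcfg hφ' hI' αQ).fanout_repl_add
        rw [hr₂', show (case5E₂ hf hd hF hC hS hcfg hφ' hI' αQ).pull (.gate kI₁) = .gate T from by rw [← hTι]; exact (case5E₂ hf hd hF hC hS hcfg hφ' hI' αQ).pull_ι T, hfanI₁, hfanD₁, hcountI, hf1'] at h1
        apply hT
        rw [hTι]
        have hiff := (case5E₂ hf hd hF hC hS hcfg hφ' hI' αQ).troubled_iff_of_fanouts (k' := T) (by rw [hTι]; exact hkI₁D)
          (fun a' i hi => by
            rw [hTι] at hi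
            have : (case5E₂ hf hd hF hC hS hcfg hφ' hI' αQ).C'.arg T a' = .var i := by rw [(case5E₂ hf hd hF hC hS hcfg hφ' hI' αQ).arg_eq_var_iff, hTι]; exact Or.inl hi
            obtain ⟨-, -, -, hfeq⟩ := hvarT a' i this
            rw [hfeq]
            obtain ⟨hCi, hix, hiy, -⟩ := hvarT a' i this
            exact (hfanu₁ hix hiy).symm)
          (by rw [hf1', hTι, hfanI₁, hgI1])
        rw [← hTι]; exact hiff.mp ⟨hand', hf1', x', y', hxy', hr', hx', hy'⟩
    | var u =>
      rw [hI] at ha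
      have hux : u ≠ x := fun h => hIx (by rw [hI, h])
      have huy : u ≠ y := fun h => hIy (by rw [hI, h])
      rcases ha with ha | ⟨z, hz, a', ha'⟩
      · cases ha
      cases hz
      have hfu : (case5E₂ hf hd hF hC hS hcfg hφ' hI' αQ).C'.fanout (.var u) = 2 := Troubled.fanout_eq_two hT' ha'
      have hfu₁ : (case5E₁ hf hd hF hC hS hcfg hφ' hI' αQ).C'.fanout (.var u) = C.fanout (.var u) := hfanu₁ hux huy
      have hcount : (univ.filter fun a'' : Fin 2 => (case5E₁ hf hd hF hC hS hcfg hφ' hI' αQ).C'.arg (case5kD hf hd hF hC hS hcfg hφ' hI' αQ) a'' = .var u).card = 1 := by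
        rw [card_eq_one]; refine ⟨aD.rev, ?_⟩; ext a''
        rw [mem_filter, mem_singleton]
        constructor
        · intro h
          rcases fin2_eq_or_eq_rev aD a'' with e' | e'
          · have := h.2; rw [e', hkDc] at this; cases this
          · exact e'
        · rintro rfl; refine ⟨mem_univ _, ?_⟩; rw [hkDrev, hI]; rfl
      have hDu : 1 ≤ C.fanout (.var u) := one_le_fanout_of_arg_eq hI
      have hand₀ : IsAndOp (C.op ((case5E₁ hf hd hF hC hS hcfg hφ' hI' αQ).ι ((case5E₂ hf hd hF hC hS hcfg hφ' hI' αQ).ι T))) := ((case5E₁ hf hd hF hC hS hcfg hφ' hI' αQ).isAndOp_iff _).mp (((case5E₂ hf hd hF hC hS hcfg hφ' hI' αQ).isAndOp_iff T).mp hT'.1)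
      have hT₀D : (case5E₁ hf hd hF hC hS hcfg hφ' hI' αQ).ι ((case5E₂ hf hd hF hC hS hcfg hφ' hI' αQ).ι T) ≠ D := fun h' => (case5E₂ hf hd hF hC hS hcfg hφ' hI' αQ).ι_ne T ((case5E₁ hf hd hF hC hS hcfg hφ' hI' αQ).ι_injective (h'.trans hkD.symm))
      -- the other wire `w` of `T`
      obtain ⟨w, hw⟩ := Troubled.arg_isVar hT' a'.rev
      have hwu : w ≠ u := by
        intro h; rw [h] at hw; exact Troubled.arg_ne hT' a' (by rw [ha', hw])
      have hfw : (case5E₂ hf hd hF hC hS hcfg hφ' hI' αQ).C'.fanout (.var w) = 2 := Troubled.fanout_eq_two hT' hw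
      have hkDw : ∀ a'', (case5E₁ hf hd hF hC hS hcfg hφ' hI' αQ).C'.arg (case5kD hf hd hF hC hS hcfg hφ' hI' αQ) a'' ≠ .var w := by
        intro a'' h
        rcases fin2_eq_or_eq_rev aD a'' with e' | e'
        · rw [e', hkDc] at h; cases h
        · rw [e', hkDrev, hI] at h; cases h; exact hwu rfl
      rcases hrepl₂ with ⟨b₂, hb₂⟩ | hr₂
      · -- `D` trivialized: `fanout_C(u) = 3`; the reader `T₀` of `u` is an ∧-gate: Case 3 makes it the output
        have h1 := (case5E₂ hf hd hF hC hS hcfg hφ' hI' αQ).fanout_var_add (i := u) (by rw [hb₂]; exact fun h => by cases h)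
        rw [hcount, hfu, hfu₁] at h1
        rw [(case5E₂ hf hd hF hC hS hcfg hφ' hI' αQ).arg_eq_var_iff] at ha'
        rcases ha' with ha' | ⟨-, ha'⟩
        swap; · rw [hb₂] at ha'; cases ha'
        rw [(case5E₁ hf hd hF hC hS hcfg hφ' hI' αQ).arg_eq_var_iff] at ha'
        rcases ha' with ha' | ⟨-, ha'⟩
        swap; · rw [hrepl₁] at ha'; cases ha'
        have hT₀u := (hC₁var.mp ha').1
        have h3 := hS.and_fanout_le u _ a' hT₀u hand₀
        have hT0 : C.fanout (.gate ((case5E₁ hf hd hF hC hS hcfg hφ' hI' αQ).ι ((case5E₂ hf hd hF hC hS hcfg hφ' hI' αQ).ι T))) = 0 := by omega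
        exact (false_of_and_out_reads_var hf (by omega) hF hC (hN.out_of_fanout_eq_zero _ hT0) hand₀ hT₀u).elim
      · have hr₂' : (case5E₂ hf hd hF hC hS hcfg hφ' hI' αQ).repl = .var u := by rw [hr₂, hI]; rfl
        have h1 := (case5E₂ hf hd hF hC hS hcfg hφ' hI' αQ).fanout_repl_add
        rw [hr₂', show (case5E₂ hf hd hF hC hS hcfg hφ' hI' αQ).pull (.var u) = .var u from rfl, hcount, hfu, hfu₁, hfanD₁] at h1
        -- `w` traced back to `C`
        have hw₂ : (case5E₂ hf hd hF hC hS hcfg hφ' hI' αQ).C'.arg T a'.rev = .var w := hw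
        have hw₁ : (case5E₁ hf hd hF hC hS hcfg hφ' hI' αQ).C'.arg ((case5E₂ hf hd hF hC hS hcfg hφ' hI' αQ).ι T) a'.rev = .var w := by
          rw [(case5E₂ hf hd hF hC hS hcfg hφ' hI' αQ).arg_eq_var_iff] at hw₂
          rcases hw₂ with h | ⟨-, h⟩
          · exact h
          · rw [hr₂'] at h; cases h; exact absurd rfl hwu
        have hw₀ : C.arg ((case5E₁ hf hd hF hC hS hcfg hφ' hI' αQ).ι ((case5E₂ hf hd hF hC hS hcfg hφ' hI' αQ).ι T)) a'.rev = .var w ∧ w ≠ x := by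
          rw [(case5E₁ hf hd hF hC hS hcfg hφ' hI' αQ).arg_eq_var_iff] at hw₁
          rcases hw₁ with h | ⟨-, h⟩
          · exact hC₁var.mp h
          · rw [hrepl₁] at h; cases h
        have hwy : w ≠ y := by
          intro h; rw [h] at hw
          exact case5_not_troubled_of_reads_y₂ hf hd hF hC hS hcfg hφ' hI' αQ hw hT'
        have hfw₁ : (case5E₁ hf hd hF hC hS hcfg hφ' hI' αQ).C'.fanout (.var w) = C.fanout (.var w) := hfanu₁ hw₀.2 hwy
        have hfw₂ : (case5E₂ hf hd hF hC hS hcfg hφ' hI' αQ).C'.fanout (.var w) = (case5E₁ hf hd hF hC hS hcfg hφ' hI' αQ).C'.fanout (.var w) :=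
          (case5E₂ hf hd hF hC hS hcfg hφ' hI' αQ).fanout_var_eq hkDw (by rw [hr₂']; exact fun h => hwu (Node.var.inj h).symm)
        -- out-degree of `T₀` is unchanged
        have hkDT : ∀ a'', (case5E₁ hf hd hF hC hS hcfg hφ' hI' αQ).C'.arg (case5kD hf hd hF hC hS hcfg hφ' hI' αQ) a'' ≠ .gate ((case5E₂ hf hd hF hC hS hcfg hφ' hI' αQ).ι T) := by
          intro a'' h
          rcases fin2_eq_or_eq_rev aD a'' with e' | e'
          · rw [e', hkDc] at h; cases h
          · rw [e', hkDrev, hI] at h; cases h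
        have hfanT₂ : (case5E₂ hf hd hF hC hS hcfg hφ' hI' αQ).C'.fanout (.gate T) = (case5E₁ hf hd hF hC hS hcfg hφ' hI' αQ).C'.fanout (.gate ((case5E₂ hf hd hF hC hS hcfg hφ' hI' αQ).ι T)) :=
          (case5E₂ hf hd hF hC hS hcfg hφ' hI' αQ).fanout_gate_eq hkDT (by rw [hr₂']; exact fun h => by cases h)
        have hfanE : C.fanout (.gate ((case5E₁ hf hd hF hC hS hcfg hφ' hI' αQ).ι ((case5E₂ hf hd hF hC hS hcfg hφ' hI' αQ).ι T))) = 1 := by rw [← hfanT₁, ← hfanT₂]; exact hT'.2.1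
        -- where does `T` read `u` from?
        rw [(case5E₂ hf hd hF hC hS hcfg hφ' hI' αQ).arg_eq_var_iff] at ha'
        rcases ha' with ha' | ⟨hTD, -⟩
        · -- `T₀` reads `u` in `C`
          have ha₁ := ha'
          rw [(case5E₁ hf hd hF hC hS hcfg hφ' hI' αQ).arg_eq_var_iff] at ha'
          rcases ha' with ha' | ⟨-, ha'⟩
          swap; · rw [hrepl₁] at ha'; cases ha'
          have hT₀u := (hC₁var.mp ha').1
          have h2u := two_le_fanout hT₀u hI hT₀D
          by_cases hD0 : C.fanout (.gate D) = 0
          · -- then `fanout_C u = 3`: Case 3 makes `T₀` the output, but the output is `D`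
            exfalso
            have hCu : C.fanout (.var u) = 3 := by omega
            have h3 := hS.and_fanout_le u _ a' hT₀u hand₀
            omega
          · have hCu : C.fanout (.var u) = 2 := by omega
            have hCD : C.fanout (.gate D) = 1 := by omega
            -- `T₁` does not read `(case5kD hf hd hF hC hS hcfg hφ' hI' αQ)` (else `D` is useless), so `T` was troubled already
            have hT₁D : ∀ a'', (case5E₁ hf hd hF hC hS hcfg hφ' hI' αQ).C'.arg ((case5E₂ hf hd hF hC hS hcfg hφ' hI' αQ).ι T) a'' ≠ .gate (case5kD hf hd hF hC hS hcfg hφ' hI' αQ) := by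
              intro a'' h
              rcases fin2_eq_or_eq_rev a' a'' with e' | e'
              · rw [e', ha₁] at h; cases h
              · rw [e', hw₁] at h; cases h
            exfalso
            apply hT
            refine ((case5E₂ hf hd hF hC hS hcfg hφ' hI' αQ).troubled_iff_of_fanouts hT₁D (fun a'' i hi => ?_) hfanT₂).mp hT'
            rcases fin2_eq_or_eq_rev a' a'' with e' | e'
            · rw [e', ha₁] at hi; cases hi; omega
            · rw [e', hw₁] at hi; cases hi; exact hfw₂
        · -- `T₀` reads `D`
          rw [(case5E₁ hf hd hF hC hS hcfg hφ' hI' αQ).arg_eq_gate_iff, hkD] at hTD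
          rcases hTD with hTD | ⟨hTD, -⟩
          swap; · exact absurd hTD (hT₀G a')
          have hT₀D' := hC₁gate.mp hTD
          have hD1 : 1 ≤ C.fanout (.gate D) := one_le_fanout_of_arg_eq hT₀D'
          by_cases hCD : C.fanout (.gate D) = 1
          · -- Case 5.4.1.1.1 configuration: excluded
            have hCu : C.fanout (.var u) = 2 := by omega
            exact absurd ⟨_, a', w, u, hand₀, hT₀D', hw₀.1, hfanE, hCD, hI, by omega, hwu, hw₀.2, hwy⟩ hAlt₃
          · have hCD2 : C.fanout (.gate D) = 2 := by omega
            have hCu : C.fanout (.var u) = 1 := by omega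
            by_cases hDand : IsAndOp (C.op D)
            · exact absurd ⟨hDand, ⟨u, hI⟩, by omega⟩ hAlt₄
            · refine ⟨u, a', w, rfl, hr₂', hCu, hCD2, hDand, hand₀, hT₀D', hw₀.1, hfanE, ?_⟩
              rw [← hfw₁, ← hfw₂]; exact hfw
  -- a new troubled gate after the elimination of `D`: Cases 5.4.1.3 / 5.4.1.4
  by_cases hBad₂ : ∃ T, (case5E₂ hf hd hF hC hS hcfg hφ' hI' αQ).C'.Troubled T ∧ ¬ (case5E₁ hf hd hF hC hS hcfg hφ' hI' αQ).C'.Troubled ((case5E₂ hf hd hF hC hS hcfg hφ' hI' αQ).ι T)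
  · obtain ⟨T, hT', hT⟩ := hBad₂
    obtain ⟨u, aE, t, hIu, -, hCu, hCD, hDn, hand₀, hED, hEt, hfanE, hft⟩ := hstep2 T hT' hT
    by_cases hup : R.Protected u
    · exact hF5 _ aE u hDn hIu hup hCu hCD hand₀ hED hfanE (Or.inl ⟨t, hEt, hft⟩)
    · exact hF6 _ aE u hDn hIu hup hCu hCD hand₀ hED hfanE (Or.inl ⟨t, hEt, hft⟩)
  push Not at hBad₂
  have hold : ∀ T, (case5E₂ hf hd hF hC hS hcfg hφ' hI' αQ).C'.Troubled T → (case5C₁ hcfg).Troubled ((case5E₁ hf hd hF hC hS hcfg hφ' hI' αQ).ι ((case5E₂ hf hd hF hC hS hcfg hφ' hI' αQ).ι T)) := fun T hT =>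
    case5E₁_noNew hf hd hF hC hS hcfg hφ' hI' αQ _ (hBad₂ T hT)
  -- `(case5kB hf hd hF hC hS hcfg hφ' hI' αQ)` keeps the out-degree of `B`
  have hkDwires : ∀ a, (case5E₁ hf hd hF hC hS hcfg hφ' hI' αQ).C'.arg (case5kD hf hd hF hC hS hcfg hφ' hI' αQ) a ≠ .gate (case5kB₁ hf hd hF hC hS hcfg hφ' hI' αQ) := by
    intro a h
    rcases fin2_eq_or_eq_rev aD a with e | e
    · rw [e, hkDc] at h; cases h
    · rw [e, hkDrev] at h
      have := congrArg (case5E₁ hf hd hF hC hS hcfg hφ' hI' αQ).embed h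
      rw [(case5E₁ hf hd hF hC hS hcfg hφ' hI' αQ).embed_pull hIG] at this
      exact hIB (this.trans (by show Node.gate ((case5E₁ hf hd hF hC hS hcfg hφ' hI' αQ).ι (case5kB₁ hf hd hF hC hS hcfg hφ' hI' αQ)) = _; rw [hkB₁]))
  have hrepl₂B : (case5E₂ hf hd hF hC hS hcfg hφ' hI' αQ).repl ≠ .gate (case5kB₁ hf hd hF hC hS hcfg hφ' hI' αQ) := by
    rcases hrepl₂ with ⟨b₂, hb₂⟩ | hr₂
    · rw [hb₂]; exact fun h => by cases h
    · rw [hr₂]; intro h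
      have := congrArg (case5E₁ hf hd hF hC hS hcfg hφ' hI' αQ).embed h
      rw [(case5E₁ hf hd hF hC hS hcfg hφ' hI' αQ).embed_pull hIG] at this
      exact hIB (this.trans (by show Node.gate ((case5E₁ hf hd hF hC hS hcfg hφ' hI' αQ).ι (case5kB₁ hf hd hF hC hS hcfg hφ' hI' αQ)) = _; rw [hkB₁]))
  have hB2fan : (case5E₂ hf hd hF hC hS hcfg hφ' hI' αQ).C'.fanout (.gate (case5kB hf hd hF hC hS hcfg hφ' hI' αQ)) = C.fanout (.gate B) := by
    rw [(case5E₂ hf hd hF hC hS hcfg hφ' hI' αQ).fanout_gate_eq (fun a => by rw [hkB]; exact hkDwires a) (by rw [hkB]; exact hrepl₂B), hkB, hfanB₁]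
  -- the output along the chain when `B` is the output
  have hout_of_B : C.out = .gate B → (case5E₂ hf hd hF hC hS hcfg hφ' hI' αQ).C'.out = .gate (case5kB hf hd hF hC hS hcfg hφ' hI' αQ) := by
    intro hout
    have h1 := (case5E₁ hf hd hF hC hS hcfg hφ' hI' αQ).out_eq
    have hC₁out : (case5C₁ hcfg).out = .gate B := by
      show (C.out).substConst x (finTwoEquiv (case5c hcfg)) = _; rw [hout]; rfl
    rw [hC₁out, if_neg (fun h => hcfg.B_ne_G (Node.gate.inj h))] at h1
    have hout₁ : (case5E₁ hf hd hF hC hS hcfg hφ' hI' αQ).C'.out = .gate (case5kB₁ hf hd hF hC hS hcfg hφ' hI' αQ) := by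
      apply (case5E₁ hf hd hF hC hS hcfg hφ' hI' αQ).embed_injective
      show (case5E₁ hf hd hF hC hS hcfg hφ' hI' αQ).C'.out.embed (case5E₁ hf hd hF hC hS hcfg hφ' hI' αQ).ι = (Node.gate (case5kB₁ hf hd hF hC hS hcfg hφ' hI' αQ) : Node n _).embed (case5E₁ hf hd hF hC hS hcfg hφ' hI' αQ).ι
      rw [h1]; show Node.gate B = Node.gate ((case5E₁ hf hd hF hC hS hcfg hφ' hI' αQ).ι (case5kB₁ hf hd hF hC hS hcfg hφ' hI' αQ)); rw [hkB₁]
    have h2 := (case5E₂ hf hd hF hC hS hcfg hφ' hI' αQ).out_eq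
    rw [hout₁, if_neg (fun h => (case5kB₁_ne hf hd hF hC hS hcfg hφ' hI' αQ) (Node.gate.inj h))] at h2
    apply (case5E₂ hf hd hF hC hS hcfg hφ' hI' αQ).embed_injective
    show (case5E₂ hf hd hF hC hS hcfg hφ' hI' αQ).C'.out.embed (case5E₂ hf hd hF hC hS hcfg hφ' hI' αQ).ι = (Node.gate (case5kB hf hd hF hC hS hcfg hφ' hI' αQ) : Node n _).embed (case5E₂ hf hd hF hC hS hcfg hφ' hI' αQ).ι
    rw [h2]; show Node.gate (case5kB₁ hf hd hF hC hS hcfg hφ' hI' αQ) = Node.gate ((case5E₂ hf hd hF hC hS hcfg hφ' hI' αQ).ι (case5kB hf hd hF hC hS hcfg hφ' hI' αQ)); rw [hkB]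
  -- the other wire `J` of `B`
  cases hJ : C.arg B aB.rev with
  | const b => exact absurd hJ (hJc b)
  | gate gJ =>
    -- `J` is a gate: no new troubled gate at the end (main strategy)
    have hgJG : gJ ≠ G := fun h => hJG (by rw [hJ, h])
    have hgJD : gJ ≠ D := fun h => hJD (by rw [hJ, h])
    have hgJB : gJ ≠ B := by
      intro h; rw [h] at hJ
      -- `B` reads itself: impossible (acyclic if `B ∉ K`; in `K`, unfair) — via the no-self-read lemma of fairness/standing
      exact not_reads_self_of_standing hF hN hS.nonDegenerate B aB.rev hJ
    obtain ⟨kJ₁, hkJ₁⟩ := (case5E₁ hf hd hF hC hS hcfg hφ' hI' αQ).ι_surj gJ hgJG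
    have hkJ₁D : kJ₁ ≠ (case5kD hf hd hF hC hS hcfg hφ' hI' αQ) := by
      intro h'; have := congrArg (case5E₁ hf hd hF hC hS hcfg hφ' hI' αQ).ι h'; rw [hkJ₁, hkD] at this; exact hgJD this
    obtain ⟨kJ₂, hkJ₂⟩ := (case5E₂ hf hd hF hC hS hcfg hφ' hI' αQ).ι_surj kJ₁ hkJ₁D
    have hJ₁ : (case5E₁ hf hd hF hC hS hcfg hφ' hI' αQ).pull ((case5C₁ hcfg).arg B aB.rev) = .gate kJ₁ := by
      rw [hC₁gate.mpr hJ |> fun h => (show (case5C₁ hcfg).arg B aB.rev = .gate gJ from hC₁gate.mpr hJ), ← hkJ₁, (case5E₁ hf hd hF hC hS hcfg hφ' hI' αQ).pull_ι]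
    have hJ₂ : (case5E₂ hf hd hF hC hS hcfg hφ' hI' αQ).C'.arg (case5kB hf hd hF hC hS hcfg hφ' hI' αQ) aB.rev = .gate kJ₂ := by rw [hB₂rev, hJ₁, ← hkJ₂, (case5E₂ hf hd hF hC hS hcfg hφ' hI' αQ).pull_ι]
    refine case5_main hf hd hF hC hS hcfg hφ' hI' αQ (fun T hT' => hBad₂ T hT') (fun T hT => ?_)
    by_contra hT₂
    obtain ⟨a, ha⟩ := (case5E₃ hf hd hF hC hS hcfg hφ' hI' αQ).causedBy_of_new_troubled T hT hT₂
    rcases fin2_eq_or_eq_rev aB a with e | e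
    · rw [e, hkBc] at ha; exact not_causedBy_const ha
    rw [e, hJ₂] at ha
    rcases ha with ha | ⟨z, hz, -⟩
    swap; · cases hz
    have hTι : (case5E₃ hf hd hF hC hS hcfg hφ' hI' αQ).ι T = kJ₂ := (Node.gate.inj ha).symm
    -- `gJ` is ∧-type, outside the xor-part, not read by... and does not read `B`, `G`
    have handJ : IsAndOp (C.op gJ) := by
      have h := ((case5E₁ hf hd hF hC hS hcfg hφ' hI' αQ).isAndOp_iff _).mp (((case5E₂ hf hd hF hC hS hcfg hφ' hI' αQ).isAndOp_iff _).mp (((case5E₃ hf hd hF hC hS hcfg hφ' hI' αQ).isAndOp_iff T).mp hT.1))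
      rwa [hTι, hkJ₂, hkJ₁] at h
    have hgJK : gJ ∉ C.xorPart := C.not_mem_xorPart_of_isAndOp handJ
    have hBK : B ∉ C.xorPart := fun hBK => hgJK (C.mem_of_arg_eq B hBK aB.rev gJ hJ)
    have hgJ_B : ∀ a', C.arg gJ a' ≠ .gate B := fun a' h => not_reads_of_reads hgJK ⟨aB.rev, hJ⟩ ⟨a', h⟩
    have hgJ_G : ∀ a', C.arg gJ a' ≠ .gate G := by
      intro a' h; have := two_le_fanout h hcfg.arg_D hgJD; have := hcfg.fanout_G; omega
    have h1 : ∀ a', (case5E₂ hf hd hF hC hS hcfg hφ' hI' αQ).C'.arg kJ₂ a' ≠ .gate (case5kB hf hd hF hC hS hcfg hφ' hI' αQ) := by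
      intro a' h
      rw [(case5E₂ hf hd hF hC hS hcfg hφ' hI' αQ).arg_eq_gate_iff, hkJ₂, hkB] at h
      rcases h with h | ⟨-, hr⟩
      · rw [(case5E₁ hf hd hF hC hS hcfg hφ' hI' αQ).arg_eq_gate_iff, hkJ₁, hkB₁] at h
        rcases h with h | ⟨h, -⟩
        · exact hgJ_B a' (hC₁gate.mp h)
        · exact hgJ_G a' (hC₁gate.mp h)
      · exact hrepl₂B hr
    have hkBvar : ∀ a' v, (case5E₂ hf hd hF hC hS hcfg hφ' hI' αQ).C'.arg (case5kB hf hd hF hC hS hcfg hφ' hI' αQ) a' ≠ .var v := by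
      intro a' v h
      rcases fin2_eq_or_eq_rev aB a' with e' | e'
      · rw [e', hkBc] at h; cases h
      · rw [e', hJ₂] at h; cases h
    have hrepl₃ : (∃ b, (case5E₃ hf hd hF hC hS hcfg hφ' hI' αQ).repl = .const b) ∨ (case5E₃ hf hd hF hC hS hcfg hφ' hI' αQ).repl = .gate kJ₂ := by
      rcases (case5E₃ hf hd hF hC hS hcfg hφ' hI' αQ).repl_cases with h | ⟨a', ha'⟩
      · exact Or.inl h
      · rcases fin2_eq_or_eq_rev aB a' with e' | e'
        · rw [e', hkBc] at ha'; exact Or.inl ⟨_, ha'.symm⟩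
        · rw [e', hJ₂] at ha'; exact Or.inr ha'.symm
    have hrepl₃var : ∀ v, (case5E₃ hf hd hF hC hS hcfg hφ' hI' αQ).repl ≠ .var v := by
      intro v h; rcases hrepl₃ with ⟨b, hb⟩ | hr
      · rw [hb] at h; cases h
      · rw [hr] at h; cases h
    have hfv : ∀ a' i, (case5E₂ hf hd hF hC hS hcfg hφ' hI' αQ).C'.arg kJ₂ a' = .var i → (case5E₃ hf hd hF hC hS hcfg hφ' hI' αQ).C'.fanout (.var i) = (case5E₂ hf hd hF hC hS hcfg hφ' hI' αQ).C'.fanout (.var i) :=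
      fun a' i _ => (case5E₃ hf hd hF hC hS hcfg hφ' hI' αQ).fanout_var_eq (fun a'' => hkBvar a'' i) (hrepl₃var i)
    -- an untouched `2`-variable wire of `gJ`: Case 3 gives `fanout_C(gJ) ≤ 1`
    have hfanJ₁ : (case5E₁ hf hd hF hC hS hcfg hφ' hI' αQ).C'.fanout (.gate kJ₁) = C.fanout (.gate gJ) := by
      rw [(case5E₁ hf hd hF hC hS hcfg hφ' hI' αQ).fanout_gate_eq (fun a' h => ?_) (by rw [hrepl₁]; exact fun h => by cases h), hkJ₁, C.fanout_substConst_gate]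
      rw [hkJ₁] at h
      rcases fin2_eq_or_eq_rev aX a' with e' | e'
      · rw [e', case5C₁_arg_G] at h; cases h
      · rw [e', case5C₁_arg_G_rev] at h; cases h
    have hwire : ∀ a' v, (case5E₃ hf hd hF hC hS hcfg hφ' hI' αQ).C'.arg T a' = .var v →
        (C.arg gJ a' = .var v ∧ v ≠ x ∧ C.arg D aD.rev ≠ .var v) ∨ (C.arg D aD.rev = .var v) := by
      intro a' v hv
      rw [(case5E₃ hf hd hF hC hS hcfg hφ' hI' αQ).arg_eq_var_iff_of_not_reads (by rw [hTι]; exact h1), hTι, (case5E₂ hf hd hF hC hS hcfg hφ' hI' αQ).arg_eq_var_iff, hkJ₂] at hv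
      rcases hv with hv | ⟨-, hv⟩
      · rw [(case5E₁ hf hd hF hC hS hcfg hφ' hI' αQ).arg_eq_var_iff, hkJ₁] at hv
        rcases hv with hv | ⟨h, -⟩
        · obtain ⟨hv₀, hvx⟩ := hC₁var.mp hv
          by_cases hIv : C.arg D aD.rev = .var v
          · exact Or.inr hIv
          · exact Or.inl ⟨hv₀, hvx, hIv⟩
        · exact absurd (hC₁gate.mp h) (hgJ_G a')
      · right
        rcases hrepl₂ with ⟨b₂, hb₂⟩ | hr₂
        · rw [hb₂] at hv; cases hv
        · rw [hr₂] at hv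
          cases hI : C.arg D aD.rev with
          | const b => exact absurd hI (hIc b)
          | var u => rw [hI] at hv; cases hv; rfl
          | gate gI =>
            rw [hI] at hv
            obtain ⟨kI₁, hkI₁⟩ := (case5E₁ hf hd hF hC hS hcfg hφ' hI' αQ).ι_surj gI (fun h => hIG (by rw [hI, h]))
            rw [← hkI₁, (case5E₁ hf hd hF hC hS hcfg hφ' hI' αQ).pull_ι] at hv; cases hv
    have hgood : ∀ a' v, (case5E₃ hf hd hF hC hS hcfg hφ' hI' αQ).C'.arg T a' = .var v → C.arg gJ a' = .var v → v ≠ x → C.arg D aD.rev ≠ .var v →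
        C.fanout (.gate gJ) ≤ 1 := by
      intro a' v hv hCv hvx hIv
      have hvy : v ≠ y := by
        intro h; rw [h] at hv; exact case5_not_troubled_of_reads_y₃ hf hd hF hC hS hcfg hφ' hI' αQ hBC hv hT
      have hf₃ := Troubled.fanout_eq_two hT hv
      have hv₂ : (case5E₂ hf hd hF hC hS hcfg hφ' hI' αQ).C'.arg kJ₂ a' = .var v := by
        rw [(case5E₃ hf hd hF hC hS hcfg hφ' hI' αQ).arg_eq_var_iff_of_not_reads (by rw [hTι]; exact h1), hTι] at hv; exact hv
      rw [hfv a' v hv₂] at hf₃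
      have hf₂ : (case5E₂ hf hd hF hC hS hcfg hφ' hI' αQ).C'.fanout (.var v) = (case5E₁ hf hd hF hC hS hcfg hφ' hI' αQ).C'.fanout (.var v) := by
        refine (case5E₂ hf hd hF hC hS hcfg hφ' hI' αQ).fanout_var_eq (fun a'' h => ?_) (fun h => ?_)
        · rcases fin2_eq_or_eq_rev aD a'' with e' | e'
          · rw [e', hkDc] at h; cases h
          · rw [e', hkDrev] at h
            have := congrArg (case5E₁ hf hd hF hC hS hcfg hφ' hI' αQ).embed h
            rw [(case5E₁ hf hd hF hC hS hcfg hφ' hI' αQ).embed_pull hIG] at this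
            exact hIv this
        · rcases hrepl₂ with ⟨b₂, hb₂⟩ | hr₂
          · rw [hb₂] at h; cases h
          · rw [hr₂] at h
            have := congrArg (case5E₁ hf hd hF hC hS hcfg hφ' hI' αQ).embed h
            rw [(case5E₁ hf hd hF hC hS hcfg hφ' hI' αQ).embed_pull hIG] at this
            exact hIv this
      rw [hf₂, hfanu₁ hvx hvy] at hf₃
      have h3 := hS.and_fanout_le v gJ a' hCv handJ
      omega
    obtain ⟨v₀, hv₀⟩ := Troubled.arg_isVar hT 0
    obtain ⟨v₁, hv₁⟩ := Troubled.arg_isVar hT 1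
    have hv01 : v₀ ≠ v₁ := by
      intro h; rw [h] at hv₀
      exact Troubled.arg_ne hT 0 (by rw [hv₀, show (0 : Fin 2).rev = 1 from rfl, hv₁])
    have hfanC : C.fanout (.gate gJ) ≤ 1 := by
      rcases hwire 0 v₀ hv₀ with ⟨hC₀, h0x, hI0⟩ | hI0
      · exact hgood 0 v₀ hv₀ hC₀ h0x hI0
      · rcases hwire 1 v₁ hv₁ with ⟨hC₁', h1x, hI1⟩ | hI1
        · exact hgood 1 v₁ hv₁ hC₁' h1x hI1
        · rw [hI0] at hI1; cases hI1; exact absurd rfl hv01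
    have hfanC1 : C.fanout (.gate gJ) = 1 := by have := one_le_fanout_of_arg_eq hJ; omega
    -- hence `D` does not read `gJ`, and `fanout₂(kJ₂) = 1`
    have hIJ : C.arg D aD.rev ≠ .gate gJ := by
      intro h; have := two_le_fanout h hJ (case5_B_ne_D hS hcfg).symm; omega
    have hfanJ₂ : (case5E₂ hf hd hF hC hS hcfg hφ' hI' αQ).C'.fanout (.gate kJ₂) = 1 := by
      rw [(case5E₂ hf hd hF hC hS hcfg hφ' hI' αQ).fanout_gate_eq (fun a' h => ?_) (fun h => ?_), hkJ₂, hfanJ₁, hfanC1]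
      · rw [hkJ₂] at h
        rcases fin2_eq_or_eq_rev aD a' with e' | e'
        · rw [e', hkDc] at h; cases h
        · rw [e', hkDrev] at h
          have := congrArg (case5E₁ hf hd hF hC hS hcfg hφ' hI' αQ).embed h
          rw [(case5E₁ hf hd hF hC hS hcfg hφ' hI' αQ).embed_pull hIG] at this
          exact hIJ (this.trans (by show Node.gate ((case5E₁ hf hd hF hC hS hcfg hφ' hI' αQ).ι kJ₁) = _; rw [hkJ₁]))
      · rw [hkJ₂] at h
        rcases hrepl₂ with ⟨b₂, hb₂⟩ | hr₂
        · rw [hb₂] at h; cases h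
        · rw [hr₂] at h
          have := congrArg (case5E₁ hf hd hF hC hS hcfg hφ' hI' αQ).embed h
          rw [(case5E₁ hf hd hF hC hS hcfg hφ' hI' αQ).embed_pull hIG] at this
          exact hIJ (this.trans (by show Node.gate ((case5E₁ hf hd hF hC hS hcfg hφ' hI' αQ).ι kJ₁) = _; rw [hkJ₁]))
    have hcountB : (univ.filter fun a'' : Fin 2 => (case5E₂ hf hd hF hC hS hcfg hφ' hI' αQ).C'.arg (case5kB hf hd hF hC hS hcfg hφ' hI' αQ) a'' = .gate kJ₂).card = 1 := by
      rw [card_eq_one]; refine ⟨aB.rev, ?_⟩; ext a''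
      rw [mem_filter, mem_singleton]
      constructor
      · intro h
        rcases fin2_eq_or_eq_rev aB a'' with e' | e'
        · have := h.2; rw [e', hkBc] at this; cases this
        · exact e'
      · rintro rfl; exact ⟨mem_univ _, hJ₂⟩
    rcases hrepl₃ with ⟨b₃, hb₃⟩ | hr₃
    · -- `B` trivialized: `gJ` becomes a `0`-gate
      have h2 := (case5E₃ hf hd hF hC hS hcfg hφ' hI' αQ).fanout_gate_add (k' := T) (by rw [hb₃]; exact fun h => by cases h)
      rw [hTι, hcountB, hfanJ₂] at h2
      have := hT.2.1; omega
    · -- `B` degenerate: `fanout(T) = fanout(B) = 1`, and nothing changed for `gJ`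
      have h2 := (case5E₃ hf hd hF hC hS hcfg hφ' hI' αQ).fanout_repl_add
      rw [hr₃, show (case5E₃ hf hd hF hC hS hcfg hφ' hI' αQ).pull (.gate kJ₂) = .gate T from by rw [← hTι]; exact (case5E₃ hf hd hF hC hS hcfg hφ' hI' αQ).pull_ι T, hcountB, hfanJ₂] at h2
      have hfg : (case5E₃ hf hd hF hC hS hcfg hφ' hI' αQ).C'.fanout (.gate T) = (case5E₂ hf hd hF hC hS hcfg hφ' hI' αQ).C'.fanout (.gate ((case5E₃ hf hd hF hC hS hcfg hφ' hI' αQ).ι T)) := by rw [hTι, hfanJ₂]; exact hT.2.1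
      exact hT₂ (((case5E₃ hf hd hF hC hS hcfg hφ' hI' αQ).troubled_iff_of_fanouts (by rw [hTι]; exact h1) (fun a' i hi => hfv a' i (by rw [hTι] at hi; exact hi)) hfg).mp hT)
  | var t =>
    have htx : t ≠ x := fun h => hJx (by rw [hJ, h])
    have hty : t ≠ y := fun h => hJy (by rw [hJ, h])
    have hBn : ¬ IsAndOp (C.op B) := fun h => hAlt₂ ⟨h, t, hJ⟩
    have hBxor : IsXorOp (C.op B) := C.isXorOp_of_isAffineOp hS.nonDegenerate ((isAndOp_or_isAffineOp _).resolve_left hBn)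
    have hkBt : (case5E₂ hf hd hF hC hS hcfg hφ' hI' αQ).C'.arg (case5kB hf hd hF hC hS hcfg hφ' hI' αQ) aB.rev = .var t := by
      rw [hB₂rev, (hC₁var.mpr ⟨hJ, htx⟩ : (case5C₁ hcfg).arg B aB.rev = .var t)]; rfl
    -- `(case5kB hf hd hF hC hS hcfg hφ' hI' αQ)` is ⊕-type: bypass it, the replacement node is `t`
    have hxor₂ : IsXorOp ((case5E₂ hf hd hF hC hS hcfg hφ' hI' αQ).C'.op (case5kB hf hd hF hC hS hcfg hφ' hI' αQ)) := by
      refine (case5E₂ hf hd hF hC hS hcfg hφ' hI' αQ).isXorOp_of ?_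
      rw [hkB]
      refine (case5E₁ hf hd hF hC hS hcfg hφ' hI' αQ).isXorOp_of ?_
      rw [hkB₁]
      exact hBxor
    obtain ⟨c₂, hc₂⟩ := hxor₂
    have hdeg : ∀ t', (case5E₂ hf hd hF hC hS hcfg hφ' hI' αQ).C'.liveFn (case5kB hf hd hF hC hS hcfg hφ' hI' αQ) aB (case5b hcfg) t' = (t' ^^ (case5b hcfg ^^ c₂)) := by
      intro t'
      unfold liveFn
      split_ifs <;> rw [hc₂] <;> cases t' <;> cases case5b hcfg <;> cases c₂ <;> rfl
    have hout₂ : (case5E₂ hf hd hF hC hS hcfg hφ' hI' αQ).C'.out ≠ .gate (case5kB hf hd hF hC hS hcfg hφ' hI' αQ) := out_ne_of_live_var hf hd₁ (case5E₂ hf hd hF hC hS hcfg hφ' hI' αQ).fair (case5E₂ hf hd hF hC hS hcfg hφ' hI' αQ).computes hkBc hkBt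
    let E₃ := elimDataWBypass (case5E₂ hf hd hF hC hS hcfg hφ' hI' αQ).fair (case5E₂ hf hd hF hC hS hcfg hφ' hI' αQ).computes (case5E₂ hf hd hF hC hS hcfg hφ' hI' αQ).packing (case5b hcfg ^^ c₂) hkBc hdeg hout₂ hφ' hI' αQ
    have hr₃ : E₃.repl = .var t := hkBt
    have hB0 : C.fanout (.gate B) ≠ 0 := fun h0 => hout₂ (hout_of_B (hN.out_of_fanout_eq_zero B h0))
    have hkBvar : ∀ a'' v, v ≠ t → (case5E₂ hf hd hF hC hS hcfg hφ' hI' αQ).C'.arg (case5kB hf hd hF hC hS hcfg hφ' hI' αQ) a'' ≠ .var v := by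
      intro a'' v hvt h
      rcases fin2_eq_or_eq_rev aB a'' with e' | e'
      · rw [e', hkBc] at h; cases h
      · rw [e', hkBt] at h; cases h; exact hvt rfl
    have hkBgate : ∀ a'' (g : Fin (case5E₂ hf hd hF hC hS hcfg hφ' hI' αQ).C'.m), (case5E₂ hf hd hF hC hS hcfg hφ' hI' αQ).C'.arg (case5kB hf hd hF hC hS hcfg hφ' hI' αQ) a'' ≠ .gate g := by
      intro a'' g h
      rcases fin2_eq_or_eq_rev aB a'' with e' | e'
      · rw [e', hkBc] at h; cases h
      · rw [e', hkBt] at h; cases h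
    have hcountt : (univ.filter fun a'' : Fin 2 => (case5E₂ hf hd hF hC hS hcfg hφ' hI' αQ).C'.arg (case5kB hf hd hF hC hS hcfg hφ' hI' αQ) a'' = .var t).card = 1 := by
      rw [card_eq_one]; refine ⟨aB.rev, ?_⟩; ext a''
      rw [mem_filter, mem_singleton]
      constructor
      · intro h
        rcases fin2_eq_or_eq_rev aB a'' with e' | e'
        · have := h.2; rw [e', hkBc] at this; cases this
        · exact e'
      · rintro rfl; exact ⟨mem_univ _, hkBt⟩
    have hft : E₃.C'.fanout (.var t) + 1 = (case5E₂ hf hd hF hC hS hcfg hφ' hI' αQ).C'.fanout (.var t) + C.fanout (.gate B) := by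
      have h1 := E₃.fanout_repl_add
      rw [hr₃, show E₃.pull (.var t) = .var t from rfl, hcountt, hB2fan] at h1
      exact h1
    -- is there a new troubled gate at the end?
    by_cases hBad₃ : ∃ T, E₃.C'.Troubled T ∧ ¬ (case5E₂ hf hd hF hC hS hcfg hφ' hI' αQ).C'.Troubled (E₃.ι T)
    swap
    · push Not at hBad₃
      exact case5_main'_of hf hd hF hC hS hcfg hφ' hI' αQ E₃ fun T hT => hold _ (hBad₃ T hT)
    obtain ⟨T, hT, hT₂⟩ := hBad₃
    obtain ⟨a, ha⟩ := E₃.causedBy_of_new_troubled T hT hT₂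
    rcases fin2_eq_or_eq_rev aB a with e | e
    · rw [e, hkBc] at ha; exact absurd ha not_causedBy_const
    rw [e, hkBt] at ha
    rcases ha with ha | ⟨z, hz, a', ha'⟩
    · cases ha
    cases hz
    have hft₃ : E₃.C'.fanout (.var t) = 2 := Troubled.fanout_eq_two hT ha'
    have hand₀ : IsAndOp (C.op ((case5E₁ hf hd hF hC hS hcfg hφ' hI' αQ).ι ((case5E₂ hf hd hF hC hS hcfg hφ' hI' αQ).ι (E₃.ι T)))) :=
      ((case5E₁ hf hd hF hC hS hcfg hφ' hI' αQ).isAndOp_iff _).mp (((case5E₂ hf hd hF hC hS hcfg hφ' hI' αQ).isAndOp_iff _).mp ((E₃.isAndOp_iff T).mp hT.1))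
    have hT₀G' : ∀ a'', (case5C₁ hcfg).arg ((case5E₁ hf hd hF hC hS hcfg hφ' hI' αQ).ι ((case5E₂ hf hd hF hC hS hcfg hφ' hI' αQ).ι (E₃.ι T))) a'' ≠ .gate G := by
      intro a'' h
      have hread := hC₁gate.mp h
      have := two_le_fanout hread hcfg.arg_D (fun h' => (case5E₂ hf hd hF hC hS hcfg hφ' hI' αQ).ι_ne (E₃.ι T) ((case5E₁ hf hd hF hC hS hcfg hφ' hI' αQ).ι_injective (h'.trans hkD.symm)))
      have := hcfg.fanout_G; omega
    have hfanT₁' : (case5E₁ hf hd hF hC hS hcfg hφ' hI' αQ).C'.fanout (.gate ((case5E₂ hf hd hF hC hS hcfg hφ' hI' αQ).ι (E₃.ι T))) = C.fanout (.gate ((case5E₁ hf hd hF hC hS hcfg hφ' hI' αQ).ι ((case5E₂ hf hd hF hC hS hcfg hφ' hI' αQ).ι (E₃.ι T)))) := by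
      rw [(case5E₁ hf hd hF hC hS hcfg hφ' hI' αQ).fanout_gate_eq (fun a'' h => ?_) (by rw [hrepl₁]; exact fun h => by cases h), C.fanout_substConst_gate]
      rcases fin2_eq_or_eq_rev aX a'' with e' | e'
      · rw [e', case5C₁_arg_G] at h; cases h
      · rw [e', case5C₁_arg_G_rev] at h; cases h
    -- the other wire `w` of `T`
    obtain ⟨w, hw⟩ := Troubled.arg_isVar hT a'.rev
    have hwt : w ≠ t := by
      intro h; rw [h] at hw; exact Troubled.arg_ne hT a' (by rw [ha', hw])
    have hwy : w ≠ y := by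
      intro h; rw [h] at hw
      obtain ⟨-, -, x', y', -, hr, hx', hy'⟩ := hT
      have hmem : (Node.var y : Node n _) ∈ Set.range (E₃.C'.arg T) := ⟨a'.rev, hw⟩
      rw [hr] at hmem
      have hy₃ : E₃.C'.fanout (.var y) ≤ 1 := by
        have := E₃.fanout_var_add (i := y) (by rw [hr₃]; exact fun h' => hty (Node.var.inj h'))
        have := case5_fanout_y₂ hf hd hF hC hS hcfg hφ' hI' αQ
        omega
      rcases hmem with h' | h'
      · cases h'; omega
      · cases h'; omega
    have hw₂ : (case5E₂ hf hd hF hC hS hcfg hφ' hI' αQ).C'.arg (E₃.ι T) a'.rev = .var w := by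
      rw [E₃.arg_eq_var_iff] at hw
      rcases hw with hw | ⟨-, hw⟩
      · exact hw
      · rw [hr₃] at hw; cases hw; exact absurd rfl hwt
    -- where does `T` read `t` from?
    rw [E₃.arg_eq_var_iff] at ha'
    rcases ha' with ha₂ | ⟨haB, -⟩
    · -- (3B) `T₂` reads `t` directly: only the out-degree of `t` changed, by `fanout(B) - 1`
      exfalso
      have h1 : ∀ a'', (case5E₂ hf hd hF hC hS hcfg hφ' hI' αQ).C'.arg (E₃.ι T) a'' ≠ .gate (case5kB hf hd hF hC hS hcfg hφ' hI' αQ) := by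
        intro a'' h
        rcases fin2_eq_or_eq_rev a' a'' with e' | e'
        · rw [e', ha₂] at h; cases h
        · rw [e', hw₂] at h; cases h
      have hne : E₃.ι T ≠ (case5kB hf hd hF hC hS hcfg hφ' hI' αQ) := E₃.ι_ne T
      have h2t := two_le_fanout ha₂ hkBt hne
      have hB1 : C.fanout (.gate B) = 1 := by omega
      apply hT₂
      refine (E₃.troubled_iff_of_fanouts h1 (fun a'' i hi => ?_) ?_).mp hT
      · rcases fin2_eq_or_eq_rev a' a'' with e' | e'
        · rw [e', ha₂] at hi; cases hi; omega
        · rw [e', hw₂] at hi; cases hi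
          exact E₃.fanout_var_eq (fun b => hkBvar b w hwt) (by rw [hr₃]; exact fun h => hwt (Node.var.inj h).symm)
      · exact E₃.fanout_gate_eq (fun b => hkBgate b _) (by rw [hr₃]; exact fun h => by cases h)
    · -- (3A) `T₂` reads `(case5kB hf hd hF hC hS hcfg hφ' hI' αQ)` at `a'`: `T₀` is an ∧-gate `E` reading `B`
      rw [(case5E₂ hf hd hF hC hS hcfg hφ' hI' αQ).arg_eq_gate_iff, hkB] at haB
      rcases haB with haB | ⟨-, haB⟩
      swap; · exact absurd haB hrepl₂B
      rw [(case5E₁ hf hd hF hC hS hcfg hφ' hI' αQ).arg_eq_gate_iff, hkB₁] at haB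
      rcases haB with haB | ⟨haB, -⟩
      swap; · exact absurd haB (hT₀G' a')
      have hT₀B := hC₁gate.mp haB
      -- the origin of the other wire `w`
      rw [(case5E₂ hf hd hF hC hS hcfg hφ' hI' αQ).arg_eq_var_iff] at hw₂
      rcases hw₂ with hw₁ | ⟨hwD, hr₂w⟩
      · -- `w` is a variable wire of `E` in `C`: Case 5.4.2
        rw [(case5E₁ hf hd hF hC hS hcfg hφ' hI' αQ).arg_eq_var_iff] at hw₁
        rcases hw₁ with hw₁ | ⟨hw₁, -⟩
        swap; · exact absurd hw₁ (hT₀G' a'.rev)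
        obtain ⟨hT₀w, -⟩ := hC₁var.mp hw₁
        have h2 : C.fanout (.gate B) ≤ 2 := by
          have : 1 ≤ (case5E₂ hf hd hF hC hS hcfg hφ' hI' αQ).C'.fanout (.var t) := one_le_fanout_of_arg_eq hkBt
          omega
        by_cases hB1 : C.fanout (.gate B) = 1
        · exact absurd ⟨_, a', w, hand₀, hT₀B, hT₀w, hB1, hwy⟩ hAlt
        · exact hF7 _ a' t w hBn hJ hand₀ hT₀B hT₀w (by omega)
      · -- `w = u` comes from `D`: `E` reads `D` and `B` (Cases 5.4.1.1.3 / 5.4.1.3 / 5.4.1.4)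
        rw [(case5E₁ hf hd hF hC hS hcfg hφ' hI' αQ).arg_eq_gate_iff, hkD] at hwD
        rcases hwD with hwD | ⟨hwD, -⟩
        swap; · exact absurd hwD (hT₀G' a'.rev)
        have hT₀D := hC₁gate.mp hwD
        -- `I = var w`
        have hIw : C.arg D aD.rev = .var w := by
          rcases hrepl₂ with ⟨b₂, hb₂⟩ | hr₂
          · rw [hb₂] at hr₂w; cases hr₂w
          · rw [hr₂] at hr₂w
            have := congrArg (case5E₁ hf hd hF hC hS hcfg hφ' hI' αQ).embed hr₂w
            rw [(case5E₁ hf hd hF hC hS hcfg hφ' hI' αQ).embed_pull hIG] at this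
            exact this
        have hwx : w ≠ x := fun h => hIx (by rw [hIw, h])
        -- out-degrees: `w + D = 3`, `t + B = 3`
        have hcountD : (univ.filter fun a'' : Fin 2 => (case5E₁ hf hd hF hC hS hcfg hφ' hI' αQ).C'.arg (case5kD hf hd hF hC hS hcfg hφ' hI' αQ) a'' = .var w).card = 1 := by
          rw [card_eq_one]; refine ⟨aD.rev, ?_⟩; ext a''
          rw [mem_filter, mem_singleton]
          constructor
          · intro h
            rcases fin2_eq_or_eq_rev aD a'' with e' | e'
            · have := h.2; rw [e', hkDc] at this; cases this
            · exact e'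
          · rintro rfl; refine ⟨mem_univ _, ?_⟩; rw [hkDrev, hIw]; rfl
        have hfw₃ : E₃.C'.fanout (.var w) = 2 := Troubled.fanout_eq_two hT hw
        have hfw₃₂ : E₃.C'.fanout (.var w) = (case5E₂ hf hd hF hC hS hcfg hφ' hI' αQ).C'.fanout (.var w) :=
          E₃.fanout_var_eq (fun b => hkBvar b w hwt) (by rw [hr₃]; exact fun h => hwt (Node.var.inj h).symm)
        have hfw₂ : (case5E₂ hf hd hF hC hS hcfg hφ' hI' αQ).C'.fanout (.var w) + 1 = C.fanout (.var w) + C.fanout (.gate D) := by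
          have h1 := (case5E₂ hf hd hF hC hS hcfg hφ' hI' αQ).fanout_repl_add
          rw [hr₂w, show (case5E₂ hf hd hF hC hS hcfg hφ' hI' αQ).pull (.var w) = .var w from rfl, hcountD, hfanu₁ hwx hwy, hfanD₁] at h1
          exact h1
        have hft₂ : (case5E₂ hf hd hF hC hS hcfg hφ' hI' αQ).C'.fanout (.var t) = C.fanout (.var t) := by
          rw [(case5E₂ hf hd hF hC hS hcfg hφ' hI' αQ).fanout_var_eq (fun a'' h => ?_) (by rw [hr₂w]; exact fun h => hwt (Node.var.inj h)), hfanu₁ htx hty]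
          rcases fin2_eq_or_eq_rev aD a'' with e' | e'
          · rw [e', hkDc] at h; cases h
          · rw [e', hkDrev, hIw] at h; cases h; exact hwt rfl
        have hD1 : 1 ≤ C.fanout (.gate D) := one_le_fanout_of_arg_eq hT₀D
        have hsumD : C.fanout (.var w) + C.fanout (.gate D) = 3 := by omega
        have hsumB : C.fanout (.var t) + C.fanout (.gate B) = 3 := by omega
        -- out-degree of `E`
        have hfanE : C.fanout (.gate ((case5E₁ hf hd hF hC hS hcfg hφ' hI' αQ).ι ((case5E₂ hf hd hF hC hS hcfg hφ' hI' αQ).ι (E₃.ι T)))) = 1 := by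
          have e3 : E₃.C'.fanout (.gate T) = (case5E₂ hf hd hF hC hS hcfg hφ' hI' αQ).C'.fanout (.gate (E₃.ι T)) :=
            E₃.fanout_gate_eq (fun b => hkBgate b _) (by rw [hr₃]; exact fun h => by cases h)
          have e2 : (case5E₂ hf hd hF hC hS hcfg hφ' hI' αQ).C'.fanout (.gate (E₃.ι T)) = (case5E₁ hf hd hF hC hS hcfg hφ' hI' αQ).C'.fanout (.gate ((case5E₂ hf hd hF hC hS hcfg hφ' hI' αQ).ι (E₃.ι T))) := by
            refine (case5E₂ hf hd hF hC hS hcfg hφ' hI' αQ).fanout_gate_eq (fun a'' h => ?_) (by rw [hr₂w]; exact fun h => by cases h)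
            rcases fin2_eq_or_eq_rev aD a'' with e' | e'
            · rw [e', hkDc] at h; cases h
            · rw [e', hkDrev, hIw] at h; cases h
          rw [← hfanT₁', ← e2, ← e3]; exact hT.2.1
        have hw1 : 1 ≤ C.fanout (.var w) := one_le_fanout_of_arg_eq hIw
        by_cases hCD1 : C.fanout (.gate D) = 1
        · have hCw2 : C.fanout (.var w) = 2 := by omega
          exact hF3 _ a'.rev t w hBn hJ hand₀ hT₀D (by rw [Fin.rev_rev]; exact hT₀B) hfanE hIw hsumB hCw2 hCD1
        · have hCD2 : C.fanout (.gate D) = 2 := by omega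
          have hCw : C.fanout (.var w) = 1 := by omega
          by_cases hDand : IsAndOp (C.op D)
          · exact absurd ⟨hDand, ⟨w, hIw⟩, by omega⟩ hAlt₄
          · by_cases hwp : R.Protected w
            · exact hF5 _ a'.rev w hDand hIw hwp hCw hCD2 hand₀ hT₀D hfanE (Or.inr (by rw [Fin.rev_rev]; exact hT₀B))
            · exact hF6 _ a'.rev w hDand hIw hwp hCw hCD2 hand₀ hT₀D hfanE
                (Or.inr ⟨by rw [Fin.rev_rev]; exact hT₀B, hBn, t, hJ, hsumB⟩)


end Semicircuit

end Literature.Computability.Complexity
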